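import Literature.NumberTheory.Sieve.CFSemigroupTwistedGap
import HarnessLib

/-!
# Lasota–Yorke regularity of the congruence transfer operator

Support file (all results proved) for the named fact
`Literature.NumberTheory.Sieve.MageeOhWinter2019_uniformCounting` (`CFSemigroupCounting.lean`).
To upgrade the uniform (sup-norm) convergence `𝓜ⁿ Φ → avg(Φ) h ⊗ 𝟙` of
`CFSemigroupTwistedGap.lean` to the Lipschitz norm of `SL₂(ℤ/qℤ) → CfLip` we need the
Lasota–Yorke inequality for the twisted sums of [MageeOhWinter2019, §3.2–3.3]:

* `cfTwistSumR_eq_sum`: the explicit word sum `T_m Φ ξ x = Σ_{|w|=m} wt_w(x) Φ_{ξσ_w}(M_w x)`;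
* path regularity: contraction `|M_w x - M_w y| ≤ 2^{-|w|}|x-y|` (`abs_cfPathPoint_sub_le`),
  log-Lipschitz weights `wt_w(x) ≤ e^{4δ|x-y|} wt_w(y)` (`cfPathWt_le_exp_mul`);
* `cfTwistSumR_lasotaYorke`: for real fibres with `|Φ_ξ| ≤ M`, `Lip Φ_ξ ≤ L`,
  `|T_m Φ ξ x - T_m Φ ξ y| ≤ 4^δ (4δ e^{4δ} M + 2^{-m} L) |x - y|`, and the sup bound
  `|T_m Φ ξ x| ≤ 4^δ M` (`abs_cfTwistSumR_le_sup`). [cite: MageeOhWinter2019, Lemma 15]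

## References

* M. Magee, H. Oh, D. Winter, J. reine angew. Math. 753 (2019) 89–135, §3.2–3.3. [MageeOhWinter2019]
-/

noncomputable section

open Set
open scoped MatrixGroups

namespace Literature.NumberTheory.Sieve

variable {A : Finset ℕ}

section LY

variable (A) (hA : ∀ a ∈ A, 1 ≤ a) (h2 : 2 ≤ A.card) (q : ℕ)
include hA

/-! ### The explicit word sum -/

omit hA in
/-- `A.attach`-double sums are sums over `A × A`. [folklore] -/
theorem sum_attach_attach_eq_sum_prod (f : A → A → ℝ) :
    ∑ a ∈ A.attach, ∑ b ∈ A.attach, f a b = ∑ p : A × A, f p.1 p.2 := by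
  rw [← Finset.univ_eq_attach, ← Finset.sum_product']
  rfl

omit hA in
/-- **The explicit word sum for the real twisted sums:**
`T_m Φ ξ x = Σ_{w : Fin m → A × A} wt_w(x) Φ_{ξ σ_w}(M_w x)`. [cite: MageeOhWinter2019, §3.2] -/
theorem cfTwistSumR_eq_sum :
    ∀ (m : ℕ) (Φ : SL(2, ZMod q) → ℝ → ℝ) (ξ : SL(2, ZMod q)) (x : ℝ),
      cfTwistSumR A q m Φ ξ x = ∑ w : Fin m → A × A,
        cfPathWt A (List.ofFn w) x * Φ (ξ * cfSigmaWord A q (List.ofFn w)) (cfPathPoint A (List.ofFn w) x)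
  | 0, Φ, ξ, x => by simp [cfTwistSumR, cfPathWt, cfPathPoint]
  | m + 1, Φ, ξ, x => by
      rw [cfTwistSumR]
      simp_rw [cfTwistSumR_eq_sum m]
      rw [sum_attach_attach_eq_sum_prod]
      simp_rw [Finset.mul_sum]
      rw [← Finset.sum_product', Finset.univ_product_univ, ← (Fin.consEquiv fun _ => (A × A)).sum_comp]
      refine Finset.sum_congr rfl fun pw _ => ?_
      rcases pw with ⟨p, w⟩
      simp only [Fin.consEquiv_apply, List.ofFn_succ, Fin.cons_zero, Fin.cons_succ, cfPathWt, cfPathPoint,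
        show ∀ l : List (A × A), cfSigmaWord A q (p :: l) = cfSigma q ((p.1 : A) : ℕ) ((p.2 : A) : ℕ) * cfSigmaWord A q l from
          fun l => by rw [show p :: l = [p] ++ l from rfl, cfSigmaWord_append, cfSigmaWord_singleton], mul_assoc]

/-! ### Regularity along paths -/

/-- **Contraction along a path:** `|M_w x - M_w y| ≤ 2^{-|w|} |x - y|` on `[0,1]`. [cite: MageeOhWinter2019, §2.1] -/
theorem abs_cfPathPoint_sub_le :
    ∀ (w : List (A × A)) {x y : ℝ}, x ∈ Icc (0 : ℝ) 1 → y ∈ Icc (0 : ℝ) 1 →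
      |cfPathPoint A w x - cfPathPoint A w y| ≤ (1 / 2 : ℝ) ^ w.length * |x - y|
  | [], x, y, _, _ => by simp [cfPathPoint]
  | p :: w, x, y, hx, hy => by
      have hw2 : ∀ i, 1 ≤ (![((p.1 : A) : ℕ), ((p.2 : A) : ℕ)] : Fin 2 → ℕ) i := by
        intro i; fin_cases i
        · exact hA _ p.1.2
        · exact hA _ p.2.2
      have hc := abs_cfMoeb_sub_le_geom hw2 hx hy
      rw [cfMat_pair] at hc
      have hx' := cfMoeb_pair_mem (hA _ p.1.2) (hA _ p.2.2) hx
      have hy' := cfMoeb_pair_mem (hA _ p.1.2) (hA _ p.2.2) hy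
      rw [cfPathPoint, cfPathPoint, List.length_cons, pow_succ]
      refine (abs_cfPathPoint_sub_le w hx' hy').trans ?_
      rw [mul_assoc]
      refine mul_le_mul_of_nonneg_left (hc.trans (le_of_eq (by norm_num))) (by positivity)

omit hA in
/-- Path weights are non-negative. [folklore] -/
theorem cfPathWt_nonneg : ∀ (w : List (A × A)) (x : ℝ), 0 ≤ cfPathWt A w x
  | [], _ => by simp [cfPathWt]
  | p :: w, x => by rw [cfPathWt]; exact mul_nonneg (cfWtR_nonneg A _ _ _) (cfPathWt_nonneg w _)

include h2 in
/-- **Log-Lipschitz weights along a path:** `wt_w(x) ≤ e^{4δ|x-y|} wt_w(y)` on `[0,1]`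
(each pair contributes `2δ` times a geometrically shrinking distance). [cite: MageeOhWinter2019, Thm. 10] -/
theorem cfPathWt_le_exp_mul :
    ∀ (w : List (A × A)) {x y : ℝ}, x ∈ Icc (0 : ℝ) 1 → y ∈ Icc (0 : ℝ) 1 →
      cfPathWt A w x ≤ Real.exp (4 * cfDimension A * |x - y|) * cfPathWt A w y
  | [], x, y, _, _ => by
      simp only [cfPathWt]
      have : 1 ≤ Real.exp (4 * cfDimension A * |x - y|) :=
        Real.one_le_exp (mul_nonneg (by linarith [(cfDimension_pos hA h2).le]) (abs_nonneg _))
      linarith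
  | p :: w, x, y, hx, hy => by
      have hδ := (cfDimension_pos hA h2).le
      have hw2 : ∀ i, 1 ≤ (![((p.1 : A) : ℕ), ((p.2 : A) : ℕ)] : Fin 2 → ℕ) i := by
        intro i; fin_cases i
        · exact hA _ p.1.2
        · exact hA _ p.2.2
      have hwt := cfDenom_rpow_le_exp_mul hw2 hδ hx hy
      have hc := abs_cfMoeb_sub_le_geom hw2 hx hy
      rw [cfMat_pair] at hwt hc
      have hx' := cfMoeb_pair_mem (hA _ p.1.2) (hA _ p.2.2) hx
      have hy' := cfMoeb_pair_mem (hA _ p.1.2) (hA _ p.2.2) hy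
      have ih := cfPathWt_le_exp_mul w hx' hy'
      rw [cfPathWt, cfPathWt]
      have hpos : 0 ≤ cfPathWt A w (cfMoeb (cfGen ((p.1 : A) : ℕ) * cfGen ((p.2 : A) : ℕ)) y) := cfPathWt_nonneg A w _
      have hexp2 : Real.exp (4 * cfDimension A *
          |cfMoeb (cfGen ((p.1 : A) : ℕ) * cfGen ((p.2 : A) : ℕ)) x - cfMoeb (cfGen ((p.1 : A) : ℕ) * cfGen ((p.2 : A) : ℕ)) y|) ≤
          Real.exp (2 * cfDimension A * |x - y|) := by
        refine Real.exp_le_exp.2 ?_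
        have : |cfMoeb (cfGen ((p.1 : A) : ℕ) * cfGen ((p.2 : A) : ℕ)) x - cfMoeb (cfGen ((p.1 : A) : ℕ) * cfGen ((p.2 : A) : ℕ)) y| ≤
            (1 / 2 : ℝ) * |x - y| := hc.trans (le_of_eq (by norm_num))
        nlinarith [abs_nonneg (x - y)]
      have hsplit : Real.exp (4 * cfDimension A * |x - y|) =
          Real.exp (2 * cfDimension A * |x - y|) * Real.exp (2 * cfDimension A * |x - y|) := by
        rw [← Real.exp_add]; congr 1; ring
      unfold cfWtR
      calc ((cfDenom (cfGen ((p.1 : A) : ℕ) * cfGen ((p.2 : A) : ℕ)) x) ^ 2) ^ (-cfDimension A) *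
            cfPathWt A w (cfMoeb (cfGen ((p.1 : A) : ℕ) * cfGen ((p.2 : A) : ℕ)) x)
          ≤ (Real.exp (2 * cfDimension A * |x - y|) * ((cfDenom (cfGen ((p.1 : A) : ℕ) * cfGen ((p.2 : A) : ℕ)) y) ^ 2) ^ (-cfDimension A)) *
              (Real.exp (2 * cfDimension A * |x - y|) * cfPathWt A w (cfMoeb (cfGen ((p.1 : A) : ℕ) * cfGen ((p.2 : A) : ℕ)) y)) :=
            mul_le_mul hwt (ih.trans (mul_le_mul_of_nonneg_right hexp2 hpos)) (cfPathWt_nonneg A w _)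
              (mul_nonneg (Real.exp_pos _).le (Real.rpow_nonneg (sq_nonneg _) _))
        _ = Real.exp (4 * cfDimension A * |x - y|) *
              (((cfDenom (cfGen ((p.1 : A) : ℕ) * cfGen ((p.2 : A) : ℕ)) y) ^ 2) ^ (-cfDimension A) *
                cfPathWt A w (cfMoeb (cfGen ((p.1 : A) : ℕ) * cfGen ((p.2 : A) : ℕ)) y)) := by
            rw [hsplit]; ring

include h2 in
/-- **Lipschitz variation of the path weights:** `|wt_w(x) - wt_w(y)| ≤ 4δ e^{4δ} |x-y| wt_w(y)` on `[0,1]`.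
[cite: MageeOhWinter2019, Thm. 10] -/
theorem abs_cfPathWt_sub_le (w : List (A × A)) {x y : ℝ} (hx : x ∈ Icc (0 : ℝ) 1) (hy : y ∈ Icc (0 : ℝ) 1) :
    |cfPathWt A w x - cfPathWt A w y| ≤
      4 * cfDimension A * Real.exp (4 * cfDimension A) * |x - y| * cfPathWt A w y := by
  have hδ := (cfDimension_pos hA h2).le
  set c := 4 * cfDimension A with hc
  have hc0 : 0 ≤ c := by positivity
  have hd : |x - y| ≤ 1 := by rw [abs_le]; constructor <;> linarith [hx.1, hx.2, hy.1, hy.2]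
  -- `e^{c d} - 1 ≤ c e^{c} d` for `0 ≤ d ≤ 1`
  have hexp : Real.exp (c * |x - y|) - 1 ≤ c * Real.exp c * |x - y| := by
    have h1 : Real.exp (c * |x - y|) - 1 ≤ c * |x - y| * Real.exp (c * |x - y|) := by
      have := Real.add_one_le_exp (-(c * |x - y|))
      have hpos := Real.exp_pos (c * |x - y|)
      have hmul : Real.exp (-(c * |x - y|)) * Real.exp (c * |x - y|) = 1 := by rw [← Real.exp_add]; simp
      nlinarith [mul_le_mul_of_nonneg_right this hpos.le]
    have h2' : Real.exp (c * |x - y|) ≤ Real.exp c := Real.exp_le_exp.2 (by nlinarith [abs_nonneg (x - y)])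
    calc Real.exp (c * |x - y|) - 1 ≤ c * |x - y| * Real.exp (c * |x - y|) := h1
      _ ≤ c * |x - y| * Real.exp c := mul_le_mul_of_nonneg_left h2' (by positivity)
      _ = c * Real.exp c * |x - y| := by ring
  have hwy := cfPathWt_nonneg A w y
  have hwx := cfPathWt_nonneg A w x
  have h1 := cfPathWt_le_exp_mul A hA h2 w hx hy
  have h2'' := cfPathWt_le_exp_mul A hA h2 w hy hx
  rw [abs_sub_comm] at h2''
  rw [← hc] at h1 h2''
  rw [abs_le]
  constructor
  · -- `wt(y) - wt(x) ≤ (e^{cd} - 1) wt(x) ≤ ...`? use `wt(y) ≤ e^{cd} wt(x)` and `wt(x) ≤ wt(y) e^{cd}`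
    have : cfPathWt A w y - cfPathWt A w x ≤ (Real.exp (c * |x - y|) - 1) * cfPathWt A w y := by
      have hE : 1 ≤ Real.exp (c * |x - y|) := Real.one_le_exp (by positivity)
      -- from `wt y ≤ e wt x`: `wt y - wt x ≤ wt y - wt y / e = wt y (1 - 1/e) ≤ wt y (e - 1)`
      have hpos := Real.exp_pos (c * |x - y|)
      have hx' : cfPathWt A w y / Real.exp (c * |x - y|) ≤ cfPathWt A w x := by
        rw [div_le_iff₀ hpos]; linarith [h2'', mul_comm (Real.exp (c * |x - y|)) (cfPathWt A w x)]
      have hkey : cfPathWt A w y - cfPathWt A w y / Real.exp (c * |x - y|) ≤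
          (Real.exp (c * |x - y|) - 1) * cfPathWt A w y := by
        rw [div_eq_mul_inv]
        have hinv : 1 - (Real.exp (c * |x - y|))⁻¹ ≤ Real.exp (c * |x - y|) - 1 := by
          have := inv_le_one_of_one_le₀ hE
          have hi : (Real.exp (c * |x - y|))⁻¹ * Real.exp (c * |x - y|) = 1 := inv_mul_cancel₀ hpos.ne'
          nlinarith [inv_pos.2 hpos]
        nlinarith
      linarith
    nlinarith [mul_le_mul_of_nonneg_right hexp hwy]
  · have : cfPathWt A w x - cfPathWt A w y ≤ (Real.exp (c * |x - y|) - 1) * cfPathWt A w y := by linarith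
    nlinarith [mul_le_mul_of_nonneg_right hexp hwy]

/-! ### Lasota–Yorke for the twisted sums -/

include h2 in
/-- The total path weight is `T_m 𝟙 ≤ 4^δ`. [cite: MageeOhWinter2019, §3.2] -/
theorem sum_cfPathWt_le (m : ℕ) (ξ : SL(2, ZMod q)) {y : ℝ} (hy : y ∈ Icc (0 : ℝ) 1) :
    ∑ w : Fin m → A × A, cfPathWt A (List.ofFn w) y ≤ (4 : ℝ) ^ cfDimension A := by
  have h := cfTwistSumR_const_one_le A hA q h2 m ξ hy
  rw [cfTwistSumR_eq_sum A q m] at h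
  simpa using h

include h2 in
/-- **Sup bound:** `|T_m Φ ξ x| ≤ 4^δ M` if `|Φ| ≤ M` on `[0,1]`. [cite: MageeOhWinter2019, Lemma 15] -/
theorem abs_cfTwistSumR_le_sup {Φ : SL(2, ZMod q) → ℝ → ℝ} {M : ℝ} (hM : ∀ η, ∀ y ∈ Icc (0 : ℝ) 1, |Φ η y| ≤ M)
    (m : ℕ) (ξ : SL(2, ZMod q)) {x : ℝ} (hx : x ∈ Icc (0 : ℝ) 1) :
    |cfTwistSumR A q m Φ ξ x| ≤ (4 : ℝ) ^ cfDimension A * M := by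
  have hM0 : 0 ≤ M := (abs_nonneg _).trans (hM ξ x hx)
  have h := abs_cfTwistSumR_le A hA hM m ξ hx
  have h4 := cfTwistSumR_const_one_le A hA q h2 m ξ hx
  calc |cfTwistSumR A q m Φ ξ x| ≤ M * cfTwistSumR A q m (fun _ _ => 1) ξ x := h
    _ ≤ M * (4 : ℝ) ^ cfDimension A := mul_le_mul_of_nonneg_left h4 hM0
    _ = (4 : ℝ) ^ cfDimension A * M := mul_comm _ _

include h2 in
/-- **Lasota–Yorke inequality for the twisted sums:** for real fibres with `|Φ_ξ| ≤ M` and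
`Lip(Φ_ξ) ≤ L` on `[0,1]`,
`|T_m Φ ξ x - T_m Φ ξ y| ≤ 4^δ (4δ e^{4δ} M + 2^{-m} L) |x - y|`. [cite: MageeOhWinter2019, Lemma 15] -/
theorem cfTwistSumR_lasotaYorke {Φ : SL(2, ZMod q) → ℝ → ℝ} {M L : ℝ} (hM0 : 0 ≤ M) (hL0 : 0 ≤ L)
    (hM : ∀ η, ∀ y ∈ Icc (0 : ℝ) 1, |Φ η y| ≤ M)
    (hL : ∀ η, ∀ x ∈ Icc (0 : ℝ) 1, ∀ y ∈ Icc (0 : ℝ) 1, |Φ η x - Φ η y| ≤ L * |x - y|)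
    (m : ℕ) (ξ : SL(2, ZMod q)) {x y : ℝ} (hx : x ∈ Icc (0 : ℝ) 1) (hy : y ∈ Icc (0 : ℝ) 1) :
    |cfTwistSumR A q m Φ ξ x - cfTwistSumR A q m Φ ξ y| ≤
      (4 : ℝ) ^ cfDimension A * (4 * cfDimension A * Real.exp (4 * cfDimension A) * M + (1 / 2 : ℝ) ^ m * L) * |x - y| := by
  have hδ := (cfDimension_pos hA h2).le
  rw [cfTwistSumR_eq_sum A q m, cfTwistSumR_eq_sum A q m, ← Finset.sum_sub_distrib]
  refine (Finset.abs_sum_le_sum_abs _ _).trans ?_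
  set c := 4 * cfDimension A * Real.exp (4 * cfDimension A) with hc
  have hc0 : 0 ≤ c := by rw [hc]; positivity
  have hterm : ∀ w : Fin m → A × A,
      |cfPathWt A (List.ofFn w) x * Φ (ξ * cfSigmaWord A q (List.ofFn w)) (cfPathPoint A (List.ofFn w) x) -
        cfPathWt A (List.ofFn w) y * Φ (ξ * cfSigmaWord A q (List.ofFn w)) (cfPathPoint A (List.ofFn w) y)| ≤
      (c * M + (1 / 2 : ℝ) ^ m * L) * |x - y| * cfPathWt A (List.ofFn w) y := by
    intro w
    set l := List.ofFn w with hl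
    set η := ξ * cfSigmaWord A q l
    have hlen : l.length = m := by simp [hl]
    have hpx := cfPathPoint_mem A hA l hx
    have hpy := cfPathPoint_mem A hA l hy
    have hwy := cfPathWt_nonneg A l y
    have h1 := abs_cfPathWt_sub_le A hA h2 l hx hy
    have h2' := abs_cfPathPoint_sub_le A hA l hx hy
    rw [hlen] at h2'
    have hΦ1 := hM η _ hpx
    have hΦ2 := hL η _ hpx _ hpy
    -- `a x' - b y' = (a - b) x' + b (x' - y')`
    have e : cfPathWt A l x * Φ η (cfPathPoint A l x) - cfPathWt A l y * Φ η (cfPathPoint A l y) =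
        (cfPathWt A l x - cfPathWt A l y) * Φ η (cfPathPoint A l x) +
          cfPathWt A l y * (Φ η (cfPathPoint A l x) - Φ η (cfPathPoint A l y)) := by ring
    rw [e]
    refine (abs_add_le _ _).trans ?_
    rw [abs_mul, abs_mul, abs_of_nonneg hwy]
    have t1 : |cfPathWt A l x - cfPathWt A l y| * |Φ η (cfPathPoint A l x)| ≤ c * |x - y| * cfPathWt A l y * M :=
      mul_le_mul h1 hΦ1 (abs_nonneg _) (by positivity)
    have t2 : cfPathWt A l y * |Φ η (cfPathPoint A l x) - Φ η (cfPathPoint A l y)| ≤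
        cfPathWt A l y * (L * ((1 / 2 : ℝ) ^ m * |x - y|)) :=
      mul_le_mul_of_nonneg_left (hΦ2.trans (mul_le_mul_of_nonneg_left h2' hL0)) hwy
    nlinarith [t1, t2]
  refine (Finset.sum_le_sum fun w _ => hterm w).trans ?_
  rw [← Finset.mul_sum]
  have hs := sum_cfPathWt_le A hA h2 q m ξ hy
  have hpre : 0 ≤ (c * M + (1 / 2 : ℝ) ^ m * L) * |x - y| := by positivity
  calc (c * M + (1 / 2 : ℝ) ^ m * L) * |x - y| * ∑ w : Fin m → A × A, cfPathWt A (List.ofFn w) y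
      ≤ (c * M + (1 / 2 : ℝ) ^ m * L) * |x - y| * (4 : ℝ) ^ cfDimension A := mul_le_mul_of_nonneg_left hs hpre
    _ = (4 : ℝ) ^ cfDimension A * (c * M + (1 / 2 : ℝ) ^ m * L) * |x - y| := by ring

end LY

end Literature.NumberTheory.Sieve
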